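import Summits.ResolutionOfSingularities.ResolutionOfSingularities.Theorems.FrobeniusClosingSteerPersistentDivisorCoarsening

/-!
# Crux `Steer` (stmt-ResolutionOfSingularities-16345), chain W4.1, F-B side: PREREG-FB D·S6, pieces (P4)+(P5) —
# the V-FREE SQUEEZE «a PERSISTENT exceptional parameter and no proper coarsening force a DISCRETE rank-one valuation»
# (res-L0-w41-tri-1 g5 `VFree.lean` v2.1 427d134263c9583b; res-L0-w41-plan-1 RULING 93a / RULING 101 (i); Theses-free support)

OURS (campaign `res-hironaka`, rung L ★L-G4, slot W4.1; statements about the route's own objects — a tower of subrings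
`R i ⊆ O` of a field `K` dominated by a valuation ring `O`; they replace the role of no printed item and are NOT statements
of the manuscript under review [claim: Hironaka2017, status: under-review]; AI review is weaker than expert review).
STATEMENT & PROOF: res-L0-w41-tri-1 g5 (`L/res-L0-w41-tri-1/v69/VFree.lean` v2.1, sha16 427d134263c9583b); FILED BY NAME by
res-type-062 g15 (RULING 101 (i)) with namespace hygiene only (`SteerPreregFB.Tri1G5.VFree` ↦
`…Theorems.SwitchingDichotomy.OddBranchVFree`; `HarnessLib` import dropped); every theorem body is byte-identical to v2.1.
Definition-free; no Theses file of W4.1 is imported; nothing here is a route item.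

Pure valuation/ring brick behind «branch (O) of the F-B tail is empty» (tri-1 PREREG-FB v1.6 D·S6; under res-L0-w41-strat-2's
§σ2.27 (2) persistence fork it is the heart of (Par-P) `StrippingTailPersistentConclTwoN`): if one element `x` of
positive value is a PERSISTENT EXCEPTIONAL PARAMETER of a tower `R i₀ ≤ R (i₀+1) ≤ …` of subrings
dominated by `O` — every element of `R i` of value `< 1` becomes divisible by `x` in `R (i+1)` (strong form) or in SOME
later member `R j`, `j > i` (weak forms `valuation_eq_pow_of_persistent'` / `discrete_of_persistent'`, the form a steered run
supplies: stripping stages keep the base ring) — then, unless `O` has a proper coarsening, every non-zero element of `R i₀` has value an exact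
power of `v(x)`; hence quotients have values in `v(x)^ℤ`, and so do `p`-th powers of arbitrary
elements of `K` when `K` is purely inseparable of exponent one over the fractions of `R i₀`
(the torsor situation `K = F(t)`, `t^p ∈ F`); and a valuation in which a fixed power `N ≠ 0` of every non-zero value is
an integral power of `v(x)` is DISCRETE of rank one (`Words01Core.Discrete`, uniformiser extraction
`discrete_of_valuation_pow_eq_zpow`). The composite alternative is res-type-038's landed
`ValuationRank.hasProperCoarsening_of_forall_pow_dvd` (`…SteerPersistentDivisorCoarsening`). In the F-B setting the two
alternatives contradict CoreDatum's `¬ Discrete O` and the T-line binder `¬ HasProperCoarsening O`. [folklore]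
[cite: HeinzerEtAl2015, Remark 2.4]
-/

-- `Summit.<S>.<S>.…` duplicates the summit name by design (single-problem summit).
set_option linter.dupNamespace false

namespace Summit.ResolutionOfSingularities.ResolutionOfSingularities.Theorems.SwitchingDichotomy

namespace OddBranchVFree

open Summit.ResolutionOfSingularities.ResolutionOfSingularities.Theorems.SteerRankThinness (HasProperCoarsening)
open Summit.ResolutionOfSingularities.ResolutionOfSingularities.Theorems.SwitchingDichotomy.ValuationRank
  (hasProperCoarsening_of_forall_pow_dvd)

variable {K : Type} [Field K]

/-- Persistence bookkeeping: if no `g / x ^ n` is a unit value, then every `g / x ^ m` lies in some member `R k`,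
`k ≥ i₀`. The persistence hypothesis `h` is the WEAK form «an element of value `< 1` of a member becomes divisible by
`x` in SOME LATER member» — so that stripping stages (which keep the base ring) may be skipped (PREREG-FB v1.6.1 A5). -/
theorem div_pow_mem_of_forall_ne (O : ValuationSubring K) (R : ℕ → Subring K) (x : K) (i₀ : ℕ)
    (hRO : ∀ i, R i ≤ O.toSubring)
    (h : ∀ i, i₀ ≤ i → ∀ y ∈ R i, O.valuation y < 1 → ∃ j, i < j ∧ y / x ∈ R j)
    {g : K} (hg : g ∈ R i₀) (hne : ∀ n : ℕ, O.valuation g ≠ O.valuation x ^ n) (hx0 : x ≠ 0) :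
    ∀ m : ℕ, ∃ k, i₀ ≤ k ∧ g / x ^ m ∈ R k := by
  intro m
  induction m with
  | zero => exact ⟨i₀, le_rfl, by simpa using hg⟩
  | succ m ih =>
    obtain ⟨k, hk, hmem⟩ := ih
    have hmemO : g / x ^ m ∈ O := hRO _ hmem
    have hle : O.valuation (g / x ^ m) ≤ 1 := (O.valuation_le_one_iff _).mpr hmemO
    have hlt : O.valuation (g / x ^ m) < 1 := by
      rcases hle.lt_or_eq with hlt | heq
      · exact hlt
      · exfalso
        apply hne m
        have hxm : O.valuation (x ^ m) ≠ 0 := by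
          rw [map_pow]; exact pow_ne_zero _ ((map_ne_zero O.valuation).mpr hx0)
        rw [map_div₀, div_eq_one_iff_eq hxm, map_pow] at heq
        exact heq
    obtain ⟨j, hj, hstep⟩ := h k hk _ hmem hlt
    have e : g / x ^ m / x = g / x ^ (m + 1) := by rw [div_div, ← pow_succ]
    rw [e] at hstep
    exact ⟨j, by omega, hstep⟩

/-- **V-free squeeze (P4)+(P5a).** Persistent exceptional parameter + no proper coarsening ⇒ every non-zero
element of the bottom member has value an exact power of `v(x)`. -/
theorem valuation_eq_pow_of_persistent' (O : ValuationSubring K) (R : ℕ → Subring K) (x : K) (i₀ : ℕ)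
    (hRO : ∀ i, R i ≤ O.toSubring) (hx : x ∈ O ∧ O.valuation x < 1) (hx0 : x ≠ 0)
    (h : ∀ i, i₀ ≤ i → ∀ y ∈ R i, O.valuation y < 1 → ∃ j, i < j ∧ y / x ∈ R j)
    (hnc : ¬ HasProperCoarsening O) {g : K} (hg : g ∈ R i₀) (hg0 : g ≠ 0) :
    ∃ m : ℕ, O.valuation g = O.valuation x ^ m := by
  by_contra hne
  push Not at hne
  have hk : ∀ k : ℕ, g / x ^ k ∈ O := fun k => by
    obtain ⟨j, -, hj⟩ := div_pow_mem_of_forall_ne O R x i₀ hRO h hg hne hx0 k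
    exact hRO _ hj
  exact hnc (hasProperCoarsening_of_forall_pow_dvd O hx hx0 hg0 hk)

/-- The same with the STRONG (consecutive-member) persistence hypothesis `y / x ∈ R (i+1)`. -/
theorem valuation_eq_pow_of_persistent (O : ValuationSubring K) (R : ℕ → Subring K) (x : K) (i₀ : ℕ)
    (hRO : ∀ i, R i ≤ O.toSubring) (hx : x ∈ O ∧ O.valuation x < 1) (hx0 : x ≠ 0)
    (h : ∀ i, i₀ ≤ i → ∀ y ∈ R i, O.valuation y < 1 → y / x ∈ R (i + 1))
    (hnc : ¬ HasProperCoarsening O) {g : K} (hg : g ∈ R i₀) (hg0 : g ≠ 0) :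
    ∃ m : ℕ, O.valuation g = O.valuation x ^ m :=
  valuation_eq_pow_of_persistent' O R x i₀ hRO hx hx0
    (fun i hi y hy hv => ⟨i + 1, i.lt_succ_self, h i hi y hy hv⟩) hnc hg hg0

/-- Corollary: quotients of non-zero elements of the bottom member have values in `v(x)^ℤ`. -/
theorem valuation_div_eq_zpow_of_persistent (O : ValuationSubring K) (R : ℕ → Subring K) (x : K) (i₀ : ℕ)
    (hRO : ∀ i, R i ≤ O.toSubring) (hx : x ∈ O ∧ O.valuation x < 1) (hx0 : x ≠ 0)
    (h : ∀ i, i₀ ≤ i → ∀ y ∈ R i, O.valuation y < 1 → y / x ∈ R (i + 1))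
    (hnc : ¬ HasProperCoarsening O) {a b : K} (ha : a ∈ R i₀) (ha0 : a ≠ 0) (hb : b ∈ R i₀) (hb0 : b ≠ 0) :
    ∃ n : ℤ, O.valuation (a / b) = O.valuation x ^ n := by
  obtain ⟨m, hm⟩ := valuation_eq_pow_of_persistent O R x i₀ hRO hx hx0 h hnc ha ha0
  obtain ⟨n, hn⟩ := valuation_eq_pow_of_persistent O R x i₀ hRO hx hx0 h hnc hb hb0
  refine ⟨(m : ℤ) - (n : ℤ), ?_⟩
  have hvx : O.valuation x ≠ 0 := (map_ne_zero O.valuation).mpr hx0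
  rw [map_div₀, hm, hn, zpow_sub₀ hvx, zpow_natCast, zpow_natCast, div_eq_mul_inv]

/-- Corollary (torsor situation, exponent one): if every element of `K` has its `p`-th power a quotient of
elements of the bottom member (e.g. `K = F(t)` with `t ^ p ∈ F ⊆ Frac (R i₀)` in characteristic `p`), then
`v(z)^p ∈ v(x)^ℤ` for every `z ≠ 0` — the value group is cyclic up to the injective endomorphism `γ ↦ γ^p`,
whence `O` is discrete of rank one (words; the extraction of a uniformiser is routine). -/
theorem valuation_pow_eq_zpow_of_persistent (O : ValuationSubring K) (R : ℕ → Subring K) (x : K) (i₀ p : ℕ)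
    (hRO : ∀ i, R i ≤ O.toSubring) (hx : x ∈ O ∧ O.valuation x < 1) (hx0 : x ≠ 0)
    (h : ∀ i, i₀ ≤ i → ∀ y ∈ R i, O.valuation y < 1 → y / x ∈ R (i + 1))
    (hnc : ¬ HasProperCoarsening O)
    (hK : ∀ z : K, z ≠ 0 → ∃ a ∈ R i₀, ∃ b ∈ R i₀, a ≠ 0 ∧ b ≠ 0 ∧ z ^ p = a / b)
    {z : K} (hz : z ≠ 0) : ∃ n : ℤ, O.valuation z ^ p = O.valuation x ^ n := by
  obtain ⟨a, ha, b, hb, ha0, hb0, hzp⟩ := hK z hz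
  obtain ⟨n, hn⟩ := valuation_div_eq_zpow_of_persistent O R x i₀ hRO hx hx0 h hnc ha ha0 hb hb0
  exact ⟨n, by rw [← map_pow, hzp, hn]⟩


/-! ## (P5b) Discreteness extraction: `v(z)^N ∈ v(x)^ℤ` for all `z ≠ 0` ⇒ `Discrete O` -/

open Summit.ResolutionOfSingularities.ResolutionOfSingularities.Theorems.SwitchingDichotomy.Words (Discrete)

/-- **Uniformiser extraction (P5b).** If some fixed power `N ≠ 0` of every non-zero value is an integral power of
`v(x)` (`x ≠ 0`, `v(x) < 1`), then `O` is discrete of rank one in the sense of `Words01Core.Discrete`: the exponent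
map `e : K× → ℤ` (`v(z)^N = v(x)^{e z}`) is a homomorphism, an element `π` of value `< 1` with `e π` minimal is a
uniformiser (`e π ∣ e z` by Euclid), and `v(z) = v(π)^{e z / e π}` by injectivity of `N`-th powers. (Pattern of the
tree's `Literature…PadicLocalDiscreteValuation.isZMonoprime_ordInt`.) [folklore] -/
theorem discrete_of_valuation_pow_eq_zpow (O : ValuationSubring K) {x : K} (hx0 : x ≠ 0)
    (hx1 : O.valuation x < 1) {N : ℕ} (hN : N ≠ 0)
    (hex : ∀ z : K, z ≠ 0 → ∃ n : ℤ, O.valuation z ^ N = O.valuation x ^ n) : Discrete O := by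
  classical
  have hvx : O.valuation x ≠ 0 := (map_ne_zero O.valuation).mpr hx0
  have hvx0 : 0 < O.valuation x := zero_lt_iff.mpr hvx
  choose! e he using hex
  -- `e` detects `v < 1` and is additive
  have he_lt : ∀ z : K, z ≠ 0 → (O.valuation z < 1 ↔ 0 < e z) := by
    intro z hz
    rw [← zpow_lt_one_iff_right_of_lt_one₀ hvx0 hx1, ← he z hz, pow_lt_one_iff hN]
  have he_mul : ∀ z w : K, z ≠ 0 → w ≠ 0 → e (z * w) = e z + e w := by
    intro z w hz hw
    apply zpow_right_injective₀ hvx0 hx1.ne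
    dsimp only
    rw [← he _ (mul_ne_zero hz hw), map_mul, mul_pow, he z hz, he w hw, zpow_add₀ hvx]
  have he_one : e 1 = 0 := by
    have h := he_mul 1 1 one_ne_zero one_ne_zero
    rw [mul_one] at h
    omega
  have he_pow : ∀ z : K, z ≠ 0 → ∀ k : ℕ, e (z ^ k) = k * e z := by
    intro z hz k
    induction k with
    | zero => rw [pow_zero, he_one, Nat.cast_zero, zero_mul]
    | succ k ih => rw [pow_succ, he_mul _ _ (pow_ne_zero _ hz) hz, ih, Nat.cast_succ, add_mul, one_mul]
  have he_zpow : ∀ z : K, z ≠ 0 → ∀ k : ℤ, e (z ^ k) = k * e z := by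
    intro z hz k
    rcases Int.eq_nat_or_neg k with ⟨n, rfl | rfl⟩
    · rw [zpow_natCast, he_pow z hz n]
    · have h := he_mul (z ^ (n : ℤ)) (z ^ (-(n : ℤ))) (zpow_ne_zero _ hz) (zpow_ne_zero _ hz)
      rw [← zpow_add₀ hz, add_neg_cancel, zpow_zero, zpow_natCast, he_pow z hz n, he_one] at h
      rw [neg_mul]
      omega
  -- a uniformiser: value `< 1` with `e` minimal
  have hP : ∃ n : ℕ, ∃ z : K, z ≠ 0 ∧ O.valuation z < 1 ∧ (e z).toNat = n := ⟨_, _, hx0, hx1, rfl⟩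
  obtain ⟨π, hπ0, hπ1, hπe⟩ := Nat.find_spec hP
  have heπ : 0 < e π := (he_lt π hπ0).mp hπ1
  have hmin : ∀ y : K, y ≠ 0 → O.valuation y < 1 → e π ≤ e y := by
    intro y hy hy1
    have h := Nat.find_min' hP ⟨y, hy, hy1, rfl⟩
    rw [← hπe] at h
    have hey : 0 < e y := (he_lt y hy).mp hy1
    omega
  have hdvd : ∀ z : K, z ≠ 0 → e π ∣ e z := by
    intro z hz
    by_contra hnd
    set q := e z / e π with hq
    set r := e z % e π with hr
    have hdiv : r + e π * q = e z := Int.emod_add_mul_ediv _ _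
    have hr0 : 0 ≤ r := Int.emod_nonneg _ heπ.ne'
    have hrlt : r < e π := Int.emod_lt_of_pos _ heπ
    have hrne : r ≠ 0 := fun h0 => hnd (Int.dvd_of_emod_eq_zero h0)
    have hy0 : z * π ^ (-q) ≠ 0 := mul_ne_zero hz (zpow_ne_zero _ hπ0)
    have hey : e (z * π ^ (-q)) = r := by
      rw [he_mul _ _ hz (zpow_ne_zero _ hπ0), he_zpow π hπ0, neg_mul, mul_comm q (e π)]
      omega
    have hy1 : O.valuation (z * π ^ (-q)) < 1 := by
      rw [he_lt _ hy0, hey]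
      omega
    have h := hmin _ hy0 hy1
    rw [hey] at h
    omega
  -- conclusion
  refine ⟨π, hπ0, hπ1, fun z hz => ?_⟩
  obtain ⟨k, hk⟩ := hdvd z hz
  refine ⟨k, ?_⟩
  have hπv : O.valuation π ≠ 0 := (map_ne_zero O.valuation).mpr hπ0
  have h1 : O.valuation z ^ N = (O.valuation π ^ k) ^ N := by
    have e2 : (O.valuation π ^ k) ^ N = O.valuation π ^ (k * (N : ℤ)) := by
      rw [← zpow_natCast (O.valuation π ^ k) N, ← zpow_mul]
    have e1 : O.valuation π ^ (k * (N : ℤ)) = (O.valuation π ^ N) ^ k := by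
      rw [mul_comm, zpow_mul, zpow_natCast]
    rw [e2, e1, he π hπ0, ← zpow_mul, ← hk, he z hz]
  exact (pow_left_inj hN).mp h1

/-- **(P4)+(P5) assembled.** Persistent exceptional parameter along the tower, no proper coarsening, and every
`z ∈ K` with `z^N` (`N ≠ 0`) a quotient of non-zero elements of the bottom member ⇒ `O` is discrete of rank one —
contradicting CoreDatum's `¬ Discrete O` in the F-B setting (there `N = p`, see `pow_char_mem_of_mem_closure`).
[folklore] -/
theorem discrete_of_persistent (O : ValuationSubring K) (R : ℕ → Subring K) (x : K) (i₀ N : ℕ)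
    (hRO : ∀ i, R i ≤ O.toSubring) (hx : x ∈ O ∧ O.valuation x < 1) (hx0 : x ≠ 0)
    (h : ∀ i, i₀ ≤ i → ∀ y ∈ R i, O.valuation y < 1 → y / x ∈ R (i + 1))
    (hnc : ¬ HasProperCoarsening O) (hN : N ≠ 0)
    (hK : ∀ z : K, z ≠ 0 → ∃ a ∈ R i₀, ∃ b ∈ R i₀, a ≠ 0 ∧ b ≠ 0 ∧ z ^ N = a / b) : Discrete O :=
  discrete_of_valuation_pow_eq_zpow O hx0 hx.2 hN fun _ hz =>
    valuation_pow_eq_zpow_of_persistent O R x i₀ N hRO hx hx0 h hnc hK hz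


/-- **(P4)+(P5) assembled, WEAK persistence form** (the form a steered run supplies across stripping stages, PREREG-FB
v1.6.1 A5; use THIS as the persistence clause of the (Par) fork): persistent exceptional parameter in the weak sense
`∀ i ≥ i₀, ∀ y ∈ R i, v y < 1 → ∃ j > i, y / x ∈ R j`, no proper coarsening, and `z^N` (`N ≠ 0`) of every `z ≠ 0` a
quotient of non-zero elements of `R i₀` ⇒ `O` is discrete of rank one. [folklore] -/
theorem discrete_of_persistent' (O : ValuationSubring K) (R : ℕ → Subring K) (x : K) (i₀ N : ℕ)
    (hRO : ∀ i, R i ≤ O.toSubring) (hx : x ∈ O ∧ O.valuation x < 1) (hx0 : x ≠ 0)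
    (h : ∀ i, i₀ ≤ i → ∀ y ∈ R i, O.valuation y < 1 → ∃ j, i < j ∧ y / x ∈ R j)
    (hnc : ¬ HasProperCoarsening O) (hN : N ≠ 0)
    (hK : ∀ z : K, z ≠ 0 → ∃ a ∈ R i₀, ∃ b ∈ R i₀, a ≠ 0 ∧ b ≠ 0 ∧ z ^ N = a / b) : Discrete O := by
  refine discrete_of_valuation_pow_eq_zpow O hx0 hx.2 hN fun z hz => ?_
  obtain ⟨a, ha, b, hb, ha0, hb0, hzp⟩ := hK z hz
  obtain ⟨m, hm⟩ := valuation_eq_pow_of_persistent' O R x i₀ hRO hx hx0 h hnc ha ha0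
  obtain ⟨n, hn⟩ := valuation_eq_pow_of_persistent' O R x i₀ hRO hx hx0 h hnc hb hb0
  refine ⟨(m : ℤ) - (n : ℤ), ?_⟩
  have hvx : O.valuation x ≠ 0 := (map_ne_zero O.valuation).mpr hx0
  rw [← map_pow, hzp, map_div₀, hm, hn, zpow_sub₀ hvx, zpow_natCast, zpow_natCast, div_eq_mul_inv]

/-! ## The torsor situation supplies `hK` with `N = p`: Frobenius maps `S[t]` into `S` when `t ^ p ∈ S` -/

/-- In characteristic `p`, if `t ^ p ∈ S` then the `p`-th power of every element of the subring generated by `S`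
and `t` lies in `S` (Frobenius is a ring endomorphism). [folklore] -/
theorem pow_char_mem_of_mem_closure (p : ℕ) [Fact p.Prime] [CharP K p] (S : Subring K) (t : K)
    (ht : t ^ p ∈ S) {z : K} (hz : z ∈ Subring.closure ((S : Set K) ∪ {t})) : z ^ p ∈ S := by
  have hmap : (Subring.closure ((S : Set K) ∪ {t})).map (frobenius K p) ≤ S := by
    rw [RingHom.map_closure]
    refine Subring.closure_le.mpr ?_
    rintro _ ⟨w, hw, rfl⟩
    rcases hw with hw | hw
    · simpa [frobenius_def] using S.pow_mem hw p
    · rw [Set.mem_singleton_iff] at hw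
      subst hw
      simpa [frobenius_def] using ht
  have : frobenius K p z ∈ (Subring.closure ((S : Set K) ∪ {t})).map (frobenius K p) :=
    Subring.mem_map.mpr ⟨z, hz, rfl⟩
  simpa [frobenius_def] using hmap this

/-- Hence `hK` of `discrete_of_persistent` with `N = p`, for `K` the fractions of `S[t]`, `t ^ p ∈ S`: every
`z = P / Q` with `P, Q ∈ S[t]` non-zero has `z ^ p = P^p / Q^p` with `P^p, Q^p ∈ S`. [folklore] -/
theorem pow_char_eq_div_of_frac (p : ℕ) [Fact p.Prime] [CharP K p] (S : Subring K) (t : K) (ht : t ^ p ∈ S)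
    (hfrac : ∀ z : K, z ≠ 0 → ∃ P ∈ Subring.closure ((S : Set K) ∪ {t}),
      ∃ Q ∈ Subring.closure ((S : Set K) ∪ {t}), P ≠ 0 ∧ Q ≠ 0 ∧ z = P / Q)
    {z : K} (hz : z ≠ 0) : ∃ a ∈ S, ∃ b ∈ S, a ≠ 0 ∧ b ≠ 0 ∧ z ^ p = a / b := by
  obtain ⟨P, hP, Q, hQ, hP0, hQ0, rfl⟩ := hfrac z hz
  exact ⟨P ^ p, pow_char_mem_of_mem_closure p S t ht hP, Q ^ p, pow_char_mem_of_mem_closure p S t ht hQ,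
    pow_ne_zero _ hP0, pow_ne_zero _ hQ0, by rw [div_pow]⟩

end OddBranchVFree

end Summit.ResolutionOfSingularities.ResolutionOfSingularities.Theorems.SwitchingDichotomy

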